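import Summits.AtomisticToContinuum.Crystallization.Theorems.ExcessDecayLiouvillePhononStabilityCertFrame

/-!
# Near-certificate: the link `Ĝ Ĥ = 1` between the pulled-back metric entries

Support file for crux `PhononStability` (line `contragredient-window-collapse`), stub `stub_certLinks`.
For a contragredient pair `(A, B)` (`⟪A x, B y⟫ = ⟪x, y⟫`, i.e. `B = A⁻ᵀ`) the lifted chart variables
`Ĝᵢⱼ = ⟪A genᵢ, A genⱼ⟫` and `Ĥᵢⱼ = ⟪B dgenᵢ, B dgenⱼ⟫` (generators `gen`, dual generators `dgen` of
the period lattice) satisfy the polynomial LINK `Σₖ Ĝᵢₖ Ĥₖⱼ = δᵢⱼ` used by the SOS certificate.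

Proof: contragredience forces `B` to be injective, hence (finite dimension) surjective; writing
`A genᵢ = B x` one gets `Ĝᵢₖ = ⟪genₖ, x⟫`, so `Σₖ Ĝᵢₖ · B dgenₖ = B (Σₖ ⟪genₖ, x⟫ dgenₖ) = B x = A genᵢ`
by the covariant expansion, and `⟪A genᵢ, B dgenⱼ⟫ = ⟪genᵢ, dgenⱼ⟫ = δᵢⱼ`. Pure linear algebra in `ℝ³`.
[folklore]
-/

noncomputable section

open scoped BigOperators Classical InnerProductSpace
open Filter Set Function
open Summit.AtomisticToContinuum.Crystallization.Theorems.PhononStabilityNegative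
open Literature.MathematicalPhysics.StatisticalMechanics

namespace Summit.AtomisticToContinuum.Crystallization.Theorems.PhononStabilityCWC.Cert

local notation "E3" => EuclideanSpace ℝ (Fin 3)

/-! ## Duality of the frame -/

/-- **dual bases:** `⟪genᵢ, dgenⱼ⟫ = δᵢⱼ`. [folklore] -/
theorem inner_gen_dgen (i j : Fin 3) : inner ℝ (gen i) (dgen j) = if i = j then 1 else 0 := by
  obtain ⟨⟨a0, a1, a2⟩, ⟨b0, b1, b2⟩, ⟨c0, c1, c2⟩⟩ := gen_apply
  obtain ⟨⟨e0, e1, e2⟩, ⟨f0, f1, f2⟩, ⟨g0, g1, g2⟩⟩ := dgen_apply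
  have h3 : (√3 : ℝ) ^ 2 = 3 := Real.sq_sqrt (by norm_num)
  have h23 : (√(2 / 3) : ℝ) ^ 2 = 2 / 3 := Real.sq_sqrt (by norm_num)
  rw [inner_fin3]
  fin_cases i <;> fin_cases j <;>
    simp only [Fin.zero_eta, Fin.mk_one, Fin.reduceFinMk, a0, a1, a2, b0, b1, b2, c0, c1, c2,
      e0, e1, e2, f0, f1, f2, g0, g1, g2, Fin.isValue, Fin.reduceEq, if_true, if_false]
  · ring
  · ring
  · ring
  · linear_combination (-(1 / 6) : ℝ) * h3
  · linear_combination (1 / 3 : ℝ) * h3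
  · ring
  · ring
  · ring
  · linear_combination (3 / 2 : ℝ) * h23

/-! ## Contragredient pairs -/

/-- The right factor of a contragredient pair is injective: `B y = 0 ⇒ ⟪x, y⟫ = 0 ∀ x`. [folklore] -/
theorem injective_right_of_contragredient {A B : E3 →L[ℝ] E3} (hAB : Contragredient A B) :
    Injective B := by
  intro y₁ y₂ h
  have h0 : inner ℝ (y₁ - y₂) (y₁ - y₂) = 0 := by
    rw [← hAB, map_sub B, h, sub_self, inner_zero_right]
  exact sub_eq_zero.mp (inner_self_eq_zero.mp h0)

/-- The right factor of a contragredient pair is surjective (finite dimension). [folklore] -/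
theorem surjective_right_of_contragredient {A B : E3 →L[ℝ] E3} (hAB : Contragredient A B) :
    Surjective B :=
  (LinearMap.injective_iff_surjective (f := (B : E3 →ₗ[ℝ] E3))).1 (injective_right_of_contragredient hAB)

/-- **the lifted link, vector form:** `Σₖ Ĝᵢₖ · B dgenₖ = A genᵢ`. [folklore] -/
theorem sum_ghat_smul_eq {A B : E3 →L[ℝ] E3} (hAB : Contragredient A B) (i : Fin 3) :
    ∑ k, ghat A i k • B (dgen k) = A (gen i) := by
  obtain ⟨x, hx⟩ := surjective_right_of_contragredient hAB (A (gen i))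
  have hg : ∀ k, ghat A i k = covOf x k := fun k => by
    rw [ghat, covOf, real_inner_comm, ← hx, hAB]
  have hBx : B x = ∑ k, covOf x k • B (dgen k) := by
    conv_lhs => rw [expand_cov x]
    simp [map_sum, map_smul]
  simp_rw [hg]
  rw [← hBx, hx]

/-- **Stub `CertLinks`:** for a contragredient pair the lifted chart variables satisfy `Ĝ Ĥ = 1`,
`Σₖ ⟪A genᵢ, A genₖ⟫ ⟪B dgenₖ, B dgenⱼ⟫ = δᵢⱼ`. [folklore] -/
theorem stub_certLinks : ∀ (A B : EuclideanSpace ℝ (Fin 3) →L[ℝ] EuclideanSpace ℝ (Fin 3)),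
    Contragredient A B → ∀ i j : Fin 3, ∑ k, ghat A i k * hhat B k j = if i = j then 1 else 0 := by
  intro A B hAB i j
  calc ∑ k, ghat A i k * hhat B k j
        = inner ℝ (∑ k, ghat A i k • B (dgen k)) (B (dgen j)) := by
          rw [sum_inner]
          exact Finset.sum_congr rfl fun k _ => by rw [real_inner_smul_left, hhat]
    _ = inner ℝ (gen i) (dgen j) := by rw [sum_ghat_smul_eq hAB, hAB]
    _ = if i = j then 1 else 0 := inner_gen_dgen i j

end Summit.AtomisticToContinuum.Crystallization.Theorems.PhononStabilityCWC.Cert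

end
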